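import Summits.QuantumFields.QCD.Theorems.SpectralDefectExtinctionWegnerEstimateBallSampling
import Literature.MathematicalPhysics.QuantumLattice.SpectralLocalizer

/-!
# Bridge toward stub `portRigidity` of line `Sketch` (skeleton "ResolventCell", gen 2c) for crux
`SpectralDefectExtinction.WegnerEstimate` (item stmt-QuantumFields-8966): the FACE residual

For the junk-free port functional `badPort R` of the landed `…SketchDefs` (gen 2c), the pull-back
`φ(y) = ψ(x + proj y)` (`y ∈ portDomain R`) of a torus eigenvector `Γ₅ D_W(W, m₀, 1) ψ = λ ψ` has vanishing
PORT-PROJECTED residual at every face site of the cube (`portFaceResSq R m₀ λ w φ = 0`,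
`portRigidity_portFaceResSq_pullback_eq_zero`).  Ingredients:

* spin algebra: `γ₅ γ_μ = −γ_μ γ₅` (tree `gammaFive_mul_euclideanGamma`) and the Clifford relation `γ_μ² = 1`
  (tree `euclideanGamma_mul_self`) give `P_∓^μ · (Γ₅ · (−½)(1 ∓ γ_μ)) = 0` (`portRigidity_projMinus_mul_fwdHop`,
  `portRigidity_projPlus_mul_bwdHop`): the port projector `P_-^μ = ½(1 − γ_μ)` (resp. `P_+^μ`) kills the forward
  (resp. backward) hop block of `Γ₅ D_W`;
* geometry of the port domain (`portDomain R` = sites of `box 4 R` with at most two extreme coordinates,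
  `portFaces R` = exactly one): at a face site `y` with extreme coordinate `μ₀`, every neighbour except the outward
  one lies in the port domain (`portRigidity_face_add_mem`, `portRigidity_face_sub_mem`), and the port projector
  IS `P_-^{μ₀}` (`y μ₀ = R`) resp. `P_+^{μ₀}` (`y μ₀ = −R`) (`portRigidity_portProj_of_eq(_neg)`);
* the defect form of the sampling identity (landed `ballSampling_latticeApply_read_sub` of `…BallSampling`): at a site of the port
  domain, `latticeApply − (Γ₅ D_W ψ)(x + proj ·)` is the hop sum applied to the cut-off defect
  (`portRigidity_defect`), and a projector against such a hop sum vanishes as soon as, direction by direction,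
  either the projector kills the hop block or the defect is zero (`portRigidity_proj_hopSum_eq_zero`).

No new definitions.  Written for the line lead (prover-line-stmt-QuantumFields-8966-c2-0) by the stub worker.
-/

noncomputable section

namespace Summit.QuantumFields.QCD.Cruxes.WegnerEstimate.ResolventCell

open scoped Matrix BigOperators
open Literature.MathematicalPhysics.QuantumLattice Literature.MathematicalPhysics.QuantumFieldTheory
  Literature.Probability.LatticeModels
open Matrix

/-! ### Spin algebra: the port projectors kill the outward hop blocks -/

/-- `P_-^μ · fwdHop μ = ½(1 − γ_μ) · Γ₅ · (−½)(1 − γ_μ) = −¼ Γ₅ (1 + γ_μ)(1 − γ_μ) = 0`. -/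
theorem portRigidity_projMinus_mul_fwdHop (μ : Fin 4) :
    ((1 / 2 : ℂ) • ((1 : Matrix (Fin 4) (Fin 4) ℂ) - euclideanGamma μ)) * fwdHop μ = 0 := by
  have hanti : euclideanGamma μ * gammaFive = -(gammaFive * euclideanGamma μ) := by
    rw [gammaFive_mul_euclideanGamma, neg_neg]
  have hkey : ((1 : Matrix (Fin 4) (Fin 4) ℂ) + euclideanGamma μ) * (1 - euclideanGamma μ) = 0 := by
    rw [mul_sub, mul_one, add_mul, one_mul, euclideanGamma_mul_self]; abel
  rw [fwdHop, smul_mul_assoc, mul_smul_comm, mul_smul_comm, ← mul_assoc, sub_mul, one_mul, hanti,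
    sub_neg_eq_add, ← mul_one_add, mul_assoc, hkey, mul_zero, smul_zero, smul_zero]

/-- `P_+^μ · bwdHop μ = ½(1 + γ_μ) · Γ₅ · (−½)(1 + γ_μ) = −¼ Γ₅ (1 − γ_μ)(1 + γ_μ) = 0`. -/
theorem portRigidity_projPlus_mul_bwdHop (μ : Fin 4) :
    ((1 / 2 : ℂ) • ((1 : Matrix (Fin 4) (Fin 4) ℂ) + euclideanGamma μ)) * bwdHop μ = 0 := by
  have hanti : euclideanGamma μ * gammaFive = -(gammaFive * euclideanGamma μ) := by
    rw [gammaFive_mul_euclideanGamma, neg_neg]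
  have hkey : ((1 : Matrix (Fin 4) (Fin 4) ℂ) - euclideanGamma μ) * (1 + euclideanGamma μ) = 0 := by
    rw [mul_add, mul_one, sub_mul, one_mul, euclideanGamma_mul_self]; abel
  rw [bwdHop, smul_mul_assoc, mul_smul_comm, mul_smul_comm, ← mul_assoc, add_mul, one_mul, hanti,
    ← sub_eq_add_neg, ← mul_one_sub, mul_assoc, hkey, mul_zero, smul_zero, smul_zero]

/-- Algebraic skeleton of the face computation: a projector `P` against the hop sum of `Γ₅ D_W` applied to a
defect field, where for every direction either `P` kills the hop block or the defect vanishes. -/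
theorem portRigidity_proj_hopSum_eq_zero (P : Matrix (Fin 4) (Fin 4) ℂ) (F B : Fin 4 → Matrix (Fin 4) (Fin 4) ℂ)
    (cW dW : Fin 4 → Fin 3 → ℂ) (up um : Fin 4 → Fin 3 → Fin 4 → ℂ)
    (hp : ∀ μ, P * F μ = 0 ∨ ∀ b β, up μ b β = 0) (hm : ∀ μ, P * B μ = 0 ∨ ∀ b β, um μ b β = 0)
    (α : Fin 4) :
    ∑ β : Fin 4, P α β * ∑ μ : Fin 4, ∑ b : Fin 3, ∑ β' : Fin 4,
      (F μ β β' * cW μ b * up μ b β' + B μ β β' * dW μ b * um μ b β') = 0 := by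
  simp only [Finset.mul_sum]
  rw [Finset.sum_comm]
  refine Finset.sum_eq_zero fun μ _ => ?_
  rw [Finset.sum_comm]
  refine Finset.sum_eq_zero fun b _ => ?_
  rw [Finset.sum_comm]
  refine Finset.sum_eq_zero fun β' _ => ?_
  have h1 : ∑ β : Fin 4, P α β * (F μ β β' * cW μ b * up μ b β' + B μ β β' * dW μ b * um μ b β') =
      (P * F μ) α β' * (cW μ b * up μ b β') + (P * B μ) α β' * (dW μ b * um μ b β') := by
    rw [Matrix.mul_apply, Matrix.mul_apply, Finset.sum_mul, Finset.sum_mul, ← Finset.sum_add_distrib]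
    refine Finset.sum_congr rfl fun β _ => ?_
    ring
  rw [h1]
  rcases hp μ with h | h <;> rcases hm μ with h' | h' <;> simp [h, h']

/-! ### Geometry of the faces of the port domain -/

/-- If every extreme coordinate of `z` lies in `S` then `extremeCount R z ≤ #S`. -/
theorem portRigidity_extremeCount_le {R : ℕ} {z : Fin 4 → ℤ} (S : Finset (Fin 4))
    (h : ∀ ν, |z ν| = (R : ℤ) → ν ∈ S) : extremeCount R z ≤ S.card :=
  Finset.card_le_card fun ν hν => h ν (Finset.mem_filter.mp hν).2

/-- A face site: in the cube, with exactly one extreme coordinate `μ₀`. -/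
theorem portRigidity_face {R : ℕ} {y : Fin 4 → ℤ} (hy : y ∈ portFaces R) :
    y ∈ box 4 R ∧ ∃ μ₀ : Fin 4, ∀ ν, |y ν| = (R : ℤ) ↔ ν = μ₀ := by
  obtain ⟨hyb, hc⟩ := Finset.mem_filter.mp hy
  obtain ⟨μ₀, hμ₀⟩ := Finset.card_eq_one.mp hc
  refine ⟨hyb, μ₀, fun ν => ?_⟩
  have h := Finset.ext_iff.mp hμ₀ ν
  simpa only [Finset.mem_filter, Finset.mem_univ, true_and, Finset.mem_singleton] using h

/-- Faces lie in the port domain. -/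
theorem portRigidity_face_mem_portDomain {R : ℕ} {y : Fin 4 → ℤ} (hy : y ∈ portFaces R) : y ∈ portDomain R := by
  obtain ⟨hyb, hc⟩ := Finset.mem_filter.mp hy
  exact Finset.mem_filter.mpr ⟨hyb, by omega⟩

/-- All forward neighbours of a face site except the outward one lie in the port domain (a tangential move
keeps at most two extreme coordinates, the inward move at most one). -/
theorem portRigidity_face_add_mem {R : ℕ} {y : Fin 4 → ℤ} (hy : y ∈ portFaces R) {μ : Fin 4}
    (hμ : y μ ≠ (R : ℤ)) : y + Pi.single μ 1 ∈ portDomain R := by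
  obtain ⟨hyb, μ₀, hμ₀⟩ := portRigidity_face hy
  rw [mem_box] at hyb
  refine Finset.mem_filter.mpr
    ⟨?_, (portRigidity_extremeCount_le {μ₀, μ} fun ν hν => ?_).trans Finset.card_le_two⟩
  · rw [mem_box]
    intro ν
    by_cases h : ν = μ
    · subst h
      have := hyb ν
      rw [Pi.add_apply, Pi.single_eq_same]
      omega
    · have := hyb ν
      rw [Pi.add_apply, Pi.single_eq_of_ne h, add_zero]
      omega
  · rw [Finset.mem_insert, Finset.mem_singleton]
    by_contra hne
    push Not at hne
    rw [Pi.add_apply, Pi.single_eq_of_ne hne.2, add_zero] at hν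
    exact hne.1 ((hμ₀ ν).mp hν)

/-- All backward neighbours of a face site except the outward one lie in the port domain. -/
theorem portRigidity_face_sub_mem {R : ℕ} {y : Fin 4 → ℤ} (hy : y ∈ portFaces R) {μ : Fin 4}
    (hμ : y μ ≠ -(R : ℤ)) : y - Pi.single μ 1 ∈ portDomain R := by
  obtain ⟨hyb, μ₀, hμ₀⟩ := portRigidity_face hy
  rw [mem_box] at hyb
  refine Finset.mem_filter.mpr
    ⟨?_, (portRigidity_extremeCount_le {μ₀, μ} fun ν hν => ?_).trans Finset.card_le_two⟩
  · rw [mem_box]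
    intro ν
    by_cases h : ν = μ
    · subst h
      have := hyb ν
      rw [Pi.sub_apply, Pi.single_eq_same]
      omega
    · have := hyb ν
      rw [Pi.sub_apply, Pi.single_eq_of_ne h, sub_zero]
      omega
  · rw [Finset.mem_insert, Finset.mem_singleton]
    by_contra hne
    push Not at hne
    rw [Pi.sub_apply, Pi.single_eq_of_ne hne.2, sub_zero] at hν
    exact hne.1 ((hμ₀ ν).mp hν)

/-- At a face site with `y μ = R`, `R ≥ 1`, the port projector is `P_-^μ = ½(1 − γ_μ)` (the only active summand
of `portProj`). -/
theorem portRigidity_portProj_of_eq {R : ℕ} (hR : 1 ≤ R) {y : Fin 4 → ℤ} (hy : y ∈ portFaces R) {μ : Fin 4}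
    (hμ : y μ = (R : ℤ)) :
    portProj R y = (1 / 2 : ℂ) • ((1 : Matrix (Fin 4) (Fin 4) ℂ) - euclideanGamma μ) := by
  obtain ⟨-, μ₀, hμ₀⟩ := portRigidity_face hy
  have hμμ₀ : μ = μ₀ := (hμ₀ μ).mp (by rw [hμ]; exact abs_of_nonneg (by positivity))
  rw [portProj, Finset.sum_eq_single μ]
  · have hne : y μ ≠ -(R : ℤ) := by rw [hμ]; omega
    rw [if_pos hμ, if_neg hne, add_zero]
  · intro ν _ hne
    have hν : |y ν| ≠ (R : ℤ) := fun h => hne (((hμ₀ ν).mp h).trans hμμ₀.symm)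
    have h1 : y ν ≠ (R : ℤ) := fun h => hν (by rw [h]; exact abs_of_nonneg (by positivity))
    have h2 : y ν ≠ -(R : ℤ) := fun h => hν (by rw [h, abs_neg]; exact abs_of_nonneg (by positivity))
    rw [if_neg h1, if_neg h2, add_zero]
  · intro h
    exact absurd (Finset.mem_univ μ) h

/-- At a face site with `y μ = −R`, `R ≥ 1`, the port projector is `P_+^μ = ½(1 + γ_μ)`. -/
theorem portRigidity_portProj_of_eq_neg {R : ℕ} (hR : 1 ≤ R) {y : Fin 4 → ℤ} (hy : y ∈ portFaces R) {μ : Fin 4}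
    (hμ : y μ = -(R : ℤ)) :
    portProj R y = (1 / 2 : ℂ) • ((1 : Matrix (Fin 4) (Fin 4) ℂ) + euclideanGamma μ) := by
  obtain ⟨-, μ₀, hμ₀⟩ := portRigidity_face hy
  have hμμ₀ : μ = μ₀ := (hμ₀ μ).mp (by rw [hμ, abs_neg]; exact abs_of_nonneg (by positivity))
  rw [portProj, Finset.sum_eq_single μ]
  · have hne : y μ ≠ (R : ℤ) := by rw [hμ]; omega
    rw [if_neg hne, if_pos hμ, zero_add]
  · intro ν _ hne
    have hν : |y ν| ≠ (R : ℤ) := fun h => hne (((hμ₀ ν).mp h).trans hμμ₀.symm)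
    have h1 : y ν ≠ (R : ℤ) := fun h => hν (by rw [h]; exact abs_of_nonneg (by positivity))
    have h2 : y ν ≠ -(R : ℤ) := fun h => hν (by rw [h, abs_neg]; exact abs_of_nonneg (by positivity))
    rw [if_neg h1, if_neg h2, add_zero]
  · intro h
    exact absurd (Finset.mem_univ μ) h

/-! ### The pull-back port field of a torus vector -/

/-- On the port domain the zero extension of the pull-back port field `p ↦ ψ(x + proj p.1, p.2)` IS the
pull-back (the `if`-form is `ballSampling_portVal_pullback` of the sibling bridge `…BallSamplingPullback`). -/
theorem portRigidity_portVal_pull_of_mem {R L : ℕ} (x : TorusSite 4 L) (ψ : QuarkIdx L → ℂ) {z : Fin 4 → ℤ}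
    (hz : z ∈ portDomain R) (b : Fin 3) (γ : Fin 4) :
    portVal (fun p : ↥(portDomain R) × Fin 3 × Fin 4 => ψ (x + Torus.proj L (p.1 : Fin 4 → ℤ), p.2.1, p.2.2))
        z b γ = ψ (x + Torus.proj L z, b, γ) := by
  unfold portVal
  rw [dif_pos hz]

/-- The cube of radius `0` has no faces (its one site has four extreme coordinates). -/
theorem portRigidity_not_mem_portFaces_zero (y : Fin 4 → ℤ) : y ∉ portFaces 0 := by
  intro hy
  obtain ⟨hb, hc⟩ := Finset.mem_filter.mp hy
  rw [mem_box] at hb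
  have h0 : ∀ μ, y μ = 0 := fun μ => by have h := hb μ; push_cast at h; omega
  have h4 : extremeCount 0 y = 4 := by
    rw [extremeCount, Finset.filter_true_of_mem, Finset.card_univ, Fintype.card_fin]
    exact fun μ _ => by rw [h0 μ]; simp
  omega

/-! ### The face residual of a pulled-back eigenvector -/

/-- **Sampling identity with defect for the pull-back port field** at a site `y` of the port domain:
`latticeApply − (Γ₅ D_W ψ)(x + proj y)` is the hop sum applied to the cut-off defect (the on-site defect
vanishes since `y ∈ portDomain R`). -/
theorem portRigidity_defect {R L : ℕ} [NeZero L] (x : TorusSite 4 L) (W : GaugeConfig 4 L SU3) (m₀ : ℝ)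
    (ψ : QuarkIdx L → ℂ) {y : Fin 4 → ℤ} (hy : y ∈ portDomain R) (a : Fin 3) (α : Fin 4) :
    latticeApply m₀ (fun l => W (x + Torus.proj L l.1, l.2))
          (portVal (fun p : ↥(portDomain R) × Fin 3 × Fin 4 =>
            ψ (x + Torus.proj L (p.1 : Fin 4 → ℤ), p.2.1, p.2.2))) y a α -
        (spinorLift gammaFive * wilsonDirac (fundamentalRep (Fin 3)) W m₀ 1).mulVec ψ
          (x + Torus.proj L y, a, α) =
      ∑ μ : Fin 4, ∑ b : Fin 3, ∑ β : Fin 4,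
        (fwdHop μ α β * ((W (x + Torus.proj L y, μ) : SU3) : Matrix (Fin 3) (Fin 3) ℂ) a b *
            (portVal (fun p : ↥(portDomain R) × Fin 3 × Fin 4 =>
                ψ (x + Torus.proj L (p.1 : Fin 4 → ℤ), p.2.1, p.2.2)) (y + Pi.single μ 1) b β -
              ψ (x + Torus.proj L (y + Pi.single μ 1), b, β)) +
          bwdHop μ α β *
              (((W (x + Torus.proj L (y - Pi.single μ 1), μ))⁻¹ : SU3) : Matrix (Fin 3) (Fin 3) ℂ) a b *
            (portVal (fun p : ↥(portDomain R) × Fin 3 × Fin 4 =>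
                ψ (x + Torus.proj L (p.1 : Fin 4 → ℤ), p.2.1, p.2.2)) (y - Pi.single μ 1) b β -
              ψ (x + Torus.proj L (y - Pi.single μ 1), b, β))) := by
  have h := ballSampling_latticeApply_read_sub x W m₀ ψ
    (portVal (fun p : ↥(portDomain R) × Fin 3 × Fin 4 => ψ (x + Torus.proj L (p.1 : Fin 4 → ℤ), p.2.1, p.2.2)))
    y a α
  have h0 : ((m₀ + 4 : ℝ) : ℂ) * ∑ γ : Fin 4, gammaFive α γ *
      (portVal (fun p : ↥(portDomain R) × Fin 3 × Fin 4 => ψ (x + Torus.proj L (p.1 : Fin 4 → ℤ), p.2.1, p.2.2))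
        y a γ - ψ (x + Torus.proj L y, a, γ)) = 0 := by
    refine mul_eq_zero_of_right _ (Finset.sum_eq_zero fun γ _ => ?_)
    rw [portRigidity_portVal_pull_of_mem x ψ hy, sub_self, mul_zero]
  rw [h0, zero_add] at h
  exact h

/-- **The port-projected residual of a pulled-back eigenvector vanishes at every face site** (`R ≥ 1`): the
only cut-off neighbour of a face is the outward one, whose hop block is killed by the port projector. -/
theorem portRigidity_face_term_eq_zero {R L : ℕ} [NeZero L] (hR : 1 ≤ R) (x : TorusSite 4 L)
    (W : GaugeConfig 4 L SU3) (m₀ lam : ℝ) (ψ : QuarkIdx L → ℂ)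
    (hψ : (spinorLift gammaFive * wilsonDirac (fundamentalRep (Fin 3)) W m₀ 1).mulVec ψ = (lam : ℂ) • ψ)
    {y : Fin 4 → ℤ} (hy : y ∈ portFaces R) (a : Fin 3) (α : Fin 4) :
    ∑ β : Fin 4, portProj R y α β *
        (latticeApply m₀ (fun l => W (x + Torus.proj L l.1, l.2))
            (portVal (fun p : ↥(portDomain R) × Fin 3 × Fin 4 =>
              ψ (x + Torus.proj L (p.1 : Fin 4 → ℤ), p.2.1, p.2.2))) y a β -
          (lam : ℂ) * portVal (fun p : ↥(portDomain R) × Fin 3 × Fin 4 =>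
              ψ (x + Torus.proj L (p.1 : Fin 4 → ℤ), p.2.1, p.2.2)) y a β) = 0 := by
  have hyD : y ∈ portDomain R := portRigidity_face_mem_portDomain hy
  have hmul : ∀ β, (lam : ℂ) * portVal (fun p : ↥(portDomain R) × Fin 3 × Fin 4 =>
      ψ (x + Torus.proj L (p.1 : Fin 4 → ℤ), p.2.1, p.2.2)) y a β =
      (spinorLift gammaFive * wilsonDirac (fundamentalRep (Fin 3)) W m₀ 1).mulVec ψ (x + Torus.proj L y, a, β) :=
    fun β => by rw [hψ, Pi.smul_apply, smul_eq_mul, portRigidity_portVal_pull_of_mem x ψ hyD]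
  simp only [hmul, portRigidity_defect x W m₀ ψ hyD]
  refine portRigidity_proj_hopSum_eq_zero (portProj R y) fwdHop bwdHop
    (fun μ b => ((W (x + Torus.proj L y, μ) : SU3) : Matrix (Fin 3) (Fin 3) ℂ) a b)
    (fun μ b => (((W (x + Torus.proj L (y - Pi.single μ 1), μ))⁻¹ : SU3) : Matrix (Fin 3) (Fin 3) ℂ) a b)
    (fun μ b β => portVal (fun p : ↥(portDomain R) × Fin 3 × Fin 4 =>
        ψ (x + Torus.proj L (p.1 : Fin 4 → ℤ), p.2.1, p.2.2)) (y + Pi.single μ 1) b β -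
      ψ (x + Torus.proj L (y + Pi.single μ 1), b, β))
    (fun μ b β => portVal (fun p : ↥(portDomain R) × Fin 3 × Fin 4 =>
        ψ (x + Torus.proj L (p.1 : Fin 4 → ℤ), p.2.1, p.2.2)) (y - Pi.single μ 1) b β -
      ψ (x + Torus.proj L (y - Pi.single μ 1), b, β))
    (fun μ => ?_) (fun μ => ?_) α
  · by_cases h : y μ = (R : ℤ)
    · left
      rw [portRigidity_portProj_of_eq hR hy h]
      exact portRigidity_projMinus_mul_fwdHop μ
    · right
      intro b β
      rw [portRigidity_portVal_pull_of_mem x ψ (portRigidity_face_add_mem hy h), sub_self]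
  · by_cases h : y μ = -(R : ℤ)
    · left
      rw [portRigidity_portProj_of_eq_neg hR hy h]
      exact portRigidity_projPlus_mul_bwdHop μ
    · right
      intro b β
      rw [portRigidity_portVal_pull_of_mem x ψ (portRigidity_face_sub_mem hy h), sub_self]

/-- **Zero face residual of a pulled-back eigenvector** (every `R`; links read around `x` from ANY configuration
`W`, in particular the glued one): if `Γ₅ D_W(W, m₀, 1) ψ = λ ψ` on the torus then
`portFaceResSq R m₀ λ w (pull-back port field) = 0`. -/
theorem portRigidity_portFaceResSq_pullback_eq_zero {R L : ℕ} [NeZero L] (x : TorusSite 4 L)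
    (W : GaugeConfig 4 L SU3) (m₀ lam : ℝ) (ψ : QuarkIdx L → ℂ)
    (hψ : (spinorLift gammaFive * wilsonDirac (fundamentalRep (Fin 3)) W m₀ 1).mulVec ψ = (lam : ℂ) • ψ) :
    portFaceResSq R m₀ lam (fun l => W (x + Torus.proj L l.1, l.2))
        (fun p : ↥(portDomain R) × Fin 3 × Fin 4 => ψ (x + Torus.proj L (p.1 : Fin 4 → ℤ), p.2.1, p.2.2)) =
      0 := by
  refine Finset.sum_eq_zero fun y hy => Finset.sum_eq_zero fun a _ => Finset.sum_eq_zero fun α _ => ?_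
  rcases Nat.eq_zero_or_pos R with rfl | hR
  · exact absurd hy (portRigidity_not_mem_portFaces_zero y)
  · rw [portRigidity_face_term_eq_zero hR x W m₀ lam ψ hψ hy a α, norm_zero, zero_pow two_ne_zero]

end Summit.QuantumFields.QCD.Cruxes.WegnerEstimate.ResolventCell

end
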